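import Summits.CriticalPhenomena.CardyFormulaZ2.Theorems.CardyBoundaryCoulombGasRectilinearCardyStubRowBlocksPart13
import Summits.CriticalPhenomena.CardyFormulaZ2.Theorems.CardyBoundaryCoulombGasRectilinearCardyClosureDefs
import HarnessLib

/-!
# Stub B `stub_rowBlocks` of line `excursion-kernel-covariance`, part 15: parameter scales and the
# dictionary between the row sets of the line and the arcs of the reversed domain
# (crux `RectilinearCardy`, stmt-CriticalPhenomena-5660, route `CardyBoundaryCoulombGas`)

* `rb_scales` — the parameter scales of the ROW BLOCKS stub below a given `θ`: a scale `θ' ≤ θ` on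
  which the loop moves by `< r/16` over `3θ'` (uniform continuity, `tp_unif_cont`), the tolerance
  `ε₂ = θ'/4` and its tube constant `m₂ ≤ r/4` (`tp_tube`);
* `rb_arc_zero_eq`, `rb_tailArc_eq` — the arc `(ab) = R.arc 0` and the tail arcs `∂Ω[s, d]` of `R`
  read on the REVERSED loop `∂D(t) = ∂R(m₀ + m₃ - t)`: `R.arc 0 = ∂D([m₀ + m₃ - m₁, m₃])`,
  `tailArc R (m₀ + m₃ - tv) = ∂D([m₀, tv])`;
* `rb_rowArc_iff` — `rowArc` is the closest-arc filter of the boundary row for `∂D([tb, ta])`;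
* `rb_rowBeyond_eq_rowTail` — on a flat window, `rowBeyond v = rowTail u ∖ {v}` for the foot
  parameter `u` of `v` strictly inside the window (`kwl_mem_rowTail_iff`, `rowTail_mono`), and
  `rb_rowBeyond_iff` — the same read on the reversed loop;
* `rb_compl_arc_nonempty` — the complement of a proper arc in the frontier is nonempty.

All [folklore].
-/

noncomputable section

open Set Metric
open Literature.Probability.RandomPlanarGeometry
open Literature.Probability.LatticeModels (Site meshPoint Orient)
open Summit.CriticalPhenomena.CardyFormulaZ2.Cruxes.BoundaryDefectGaussianR.RainbowMonomialsInExcursionKernels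
  (tp_unif_cont tp_tube)
open Summit.CriticalPhenomena.CardyFormulaZ2.Theorems.LagHandOff.Negative (exists_int_of_boundary_eq)

namespace Summit.CriticalPhenomena.CardyFormulaZ2.Cruxes.RectilinearCardy.ExcursionKernelCovariance

/-! ### Parameter scales -/

/-- **The parameter scales of the stub.** Below a given `θ ∈ (0, 1]`: a scale `θ' ≤ θ` with
`dist (∂D(s), ∂D(t)) < r/16` whenever `|s - t| ≤ 3θ'`, the tolerance `ε₂ > 0` with `4ε₂ ≤ θ'`, and a
tube constant `0 < m₂ ≤ r/4`: parameters whose difference is `ε₂`-far from every integer have images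
`m₂`-apart. [folklore] -/
theorem rb_scales (D : JordanDomain) {r θ : ℝ} (hr : 0 < r) (hθ : 0 < θ) (hθ1 : θ ≤ 1) :
    ∃ θ' ε₂ m₂ : ℝ, 0 < ε₂ ∧ 4 * ε₂ ≤ θ' ∧ θ' ≤ θ ∧
      (∀ s t : ℝ, |s - t| ≤ 3 * θ' → dist (D.boundary s) (D.boundary t) < r / 16) ∧
      0 < m₂ ∧ m₂ ≤ r / 4 ∧
      (∀ s t : ℝ, (∀ n : ℤ, ε₂ ≤ |s - t - n|) → m₂ ≤ dist (D.boundary s) (D.boundary t)) := by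
  obtain ⟨d, hd, hcont⟩ := tp_unif_cont D (ε := r / 16) (by positivity)
  set θ' : ℝ := min θ (d / 4) with hθ'
  have hθ'0 : 0 < θ' := lt_min hθ (by positivity)
  have hθ'θ : θ' ≤ θ := min_le_left _ _
  have hθ'd : θ' ≤ d / 4 := min_le_right _ _
  obtain ⟨c, hc, htube⟩ := tp_tube D (η := θ' / 4) (by positivity) (by linarith)
  refine ⟨θ', θ' / 4, min c (r / 4), by positivity, by linarith, hθ'θ, fun s t hst => hcont s t ?_,
    lt_min hc (by positivity), min_le_right _ _, fun s t hst => (min_le_left _ _).trans (htube s t hst)⟩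
  linarith

/-! ### Arcs of `R` on the reversed loop -/

/-- **The arc `(ab)` on the reversed loop**: `R.arc 0 = ∂D([m₀ + m₃ - m₁, m₃])`. [folklore] -/
theorem rb_arc_zero_eq (R : ConformalRectangle) (D : JordanDomain)
    (hDb : ∀ t : ℝ, D.boundary t = R.boundary (R.mark 0 + R.mark 3 - t)) :
    R.arc 0 = D.boundary '' Icc (R.mark 0 + R.mark 3 - R.mark 1) (R.mark 3) := by
  ext z
  rw [MarkedDomain.arc, R.nextMark_zero]
  constructor
  · rintro ⟨t, ht, rfl⟩
    refine ⟨R.mark 0 + R.mark 3 - t, ⟨by linarith [ht.2], by linarith [ht.1]⟩, ?_⟩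
    rw [hDb, show R.mark 0 + R.mark 3 - (R.mark 0 + R.mark 3 - t) = t by ring]
  · rintro ⟨t, ht, rfl⟩
    exact ⟨R.mark 0 + R.mark 3 - t, ⟨by linarith [ht.2], by linarith [ht.1]⟩, (hDb t).symm⟩

/-- **Tail arcs on the reversed loop**: `tailArc R (m₀ + m₃ - tv) = ∂D([td - 1, tv])` for
`td = m₀ + 1`. [folklore] -/
theorem rb_tailArc_eq (R : ConformalRectangle) (D : JordanDomain)
    (hDb : ∀ t : ℝ, D.boundary t = R.boundary (R.mark 0 + R.mark 3 - t)) {td : ℝ} (htd : td = R.mark 0 + 1)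
    (tv : ℝ) : D.boundary '' Icc (td - 1) tv = tailArc R (R.mark 0 + R.mark 3 - tv) := by
  subst htd
  ext z
  unfold tailArc
  constructor
  · rintro ⟨t, ht, rfl⟩
    exact ⟨R.mark 0 + R.mark 3 - t, ⟨by linarith [ht.2], by linarith [ht.1]⟩, (hDb t).symm⟩
  · rintro ⟨t, ht, rfl⟩
    refine ⟨R.mark 0 + R.mark 3 - t, ⟨by linarith [ht.2], by linarith [ht.1]⟩, ?_⟩
    rw [hDb, show R.mark 0 + R.mark 3 - (R.mark 0 + R.mark 3 - t) = t by ring]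

/-- **`rowArc` on the reversed loop**: the closest-arc filter of the boundary row for
`∂D([tb, ta])`, `tb = m₀ + m₃ - m₁`, `ta = m₃`. [folklore] -/
theorem rb_rowArc_iff (R : ConformalRectangle) (D : JordanDomain) (hDc : D.carrier = R.carrier)
    (hDb : ∀ t : ℝ, D.boundary t = R.boundary (R.mark 0 + R.mark 3 - t)) {tb ta : ℝ}
    (htb : tb = R.mark 0 + R.mark 3 - R.mark 1) (hta : ta = R.mark 3) (δ : ℝ) :
    ∀ y : Site 2, y ∈ rowArc R δ ↔ y ∈ boundaryRow R δ ∧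
      infDist (meshPoint δ y) (D.boundary '' Icc tb ta) ≤
        infDist (meshPoint δ y) (frontier D.carrier \ D.boundary '' Icc tb ta) := by
  intro y
  rw [mem_rowArc_iff, rb_arc_zero_eq R D hDb, hDc, htb, hta]

/-! ### `rowBeyond` on a flat window -/

/-- **`rowBeyond v = rowTail u ∖ {v}` on a flat window.** Along a window `[σ, σ']` strictly inside
`(m₁, m₃)` carrying a frame `(o, h)` of radius `r ≥ 2δ`, for a boundary-row vertex `v` on the row
`nrm o v = ⌈h/δ⌉` whose foot is the window point `∂R(u)` with `σ < u < σ'`: a boundary-row vertex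
`w ≠ v` lies in every tail containing `v` iff it lies in the tail from `u` (`kwl_mem_rowTail_iff`:
`v ∈ rowTail s ↔ s ≤ u` on the window; `rowTail_mono` outside). [folklore] -/
theorem rb_rowBeyond_eq_rowTail (R : ConformalRectangle) {o : Orient} {h r σ σ' : ℝ}
    (h1 : R.mark 1 < σ) (h3 : σ' < R.mark 3)
    (hcl : ∀ t ∈ Icc σ σ', ∀ z, dist z (R.boundary t) < r → (z ∈ closure R.carrier ↔ h ≤ Orient.nrmC o z))
    (hop : ∀ t ∈ Icc σ σ', ∀ z, dist z (R.boundary t) < r → (z ∈ R.carrier ↔ h < Orient.nrmC o z))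
    {δ : ℝ} (hδ : 0 < δ) (hδr : 2 * δ ≤ r) {v : Site 2} (hv : v ∈ boundaryRow R δ)
    (hvn : Orient.nrm o v = ⌈h / δ⌉) {u : ℝ} (hu : u ∈ Ioo σ σ')
    (hfoot : R.boundary u = (((δ * (Orient.tng o v : ℝ) : ℝ)) : ℂ) * Orient.e o + ((h : ℝ) : ℂ) * Orient.ν o) :
    ∀ w : Site 2, w ∈ rowBeyond R δ v ↔ w ∈ boundaryRow R δ ∧ w ≠ v ∧ w ∈ rowTail R δ u := by
  have hu' : u ∈ Icc σ σ' := ⟨hu.1.le, hu.2.le⟩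
  have hkey : ∀ {s : ℝ}, s ∈ Icc σ σ' → (v ∈ rowTail R δ s ↔ s ≤ u) := fun hs =>
    kwl_mem_rowTail_iff R h1 h3 hcl hop hδ hδr hv hvn hu' hfoot hs
  have hvu : v ∈ rowTail R δ u := (hkey hu').2 le_rfl
  intro w
  rw [mem_rowBeyond_iff]
  refine ⟨fun ⟨hw, hne, hall⟩ => ⟨hw, hne, hall u ⟨by linarith [hu.1], by linarith [hu.2]⟩ hvu⟩,
    fun ⟨hw, hne, hwu⟩ => ⟨hw, hne, fun s hs hvs => ?_⟩⟩
  rcases le_or_gt s u with hsu | hsu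
  · exact rowTail_mono R δ hs.1 hsu (by linarith [hu.2]) hwu
  · exfalso
    rcases le_or_gt s σ' with hsσ | hsσ
    · have := (hkey ⟨by linarith [hu.1], hsσ⟩).1 hvs
      linarith
    · have hvσ : v ∈ rowTail R δ σ' := rowTail_mono R δ (by linarith [hu.1, hu.2]) hsσ.le hs.2 hvs
      have := (hkey ⟨hu'.1.trans hu'.2, le_rfl⟩).1 hvσ
      linarith [hu.2]

/-- **`rowBeyond` on the reversed loop.** With the data of `rb_rowBeyond_eq_rowTail` for the foot
parameter `u = m₀ + m₃ - tv` of `v`: `w ∈ rowBeyond v` iff `w` is a boundary-row vertex other than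
`v` attributed to the arc `∂D([td - 1, tv])` (`td = m₀ + 1`) by the closest-arc rule. [folklore] -/
theorem rb_rowBeyond_iff (R : ConformalRectangle) (D : JordanDomain) (hDc : D.carrier = R.carrier)
    (hDb : ∀ t : ℝ, D.boundary t = R.boundary (R.mark 0 + R.mark 3 - t)) {o : Orient} {h r σ σ' : ℝ}
    (h1 : R.mark 1 < σ) (h3 : σ' < R.mark 3)
    (hcl : ∀ t ∈ Icc σ σ', ∀ z, dist z (R.boundary t) < r → (z ∈ closure R.carrier ↔ h ≤ Orient.nrmC o z))
    (hop : ∀ t ∈ Icc σ σ', ∀ z, dist z (R.boundary t) < r → (z ∈ R.carrier ↔ h < Orient.nrmC o z))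
    {δ : ℝ} (hδ : 0 < δ) (hδr : 2 * δ ≤ r) {v : Site 2} (hv : v ∈ boundaryRow R δ)
    (hvn : Orient.nrm o v = ⌈h / δ⌉) {tv td : ℝ} (htd : td = R.mark 0 + 1)
    (hu : R.mark 0 + R.mark 3 - tv ∈ Ioo σ σ')
    (hfoot : D.boundary tv = (((δ * (Orient.tng o v : ℝ) : ℝ)) : ℂ) * Orient.e o + ((h : ℝ) : ℂ) * Orient.ν o) :
    ∀ w : Site 2, w ∈ rowBeyond R δ v ↔ w ∈ boundaryRow R δ ∧ w ≠ v ∧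
      infDist (meshPoint δ w) (D.boundary '' Icc (td - 1) tv) ≤
        infDist (meshPoint δ w) (frontier D.carrier \ D.boundary '' Icc (td - 1) tv) := by
  have hfoot' : R.boundary (R.mark 0 + R.mark 3 - tv) =
      (((δ * (Orient.tng o v : ℝ) : ℝ)) : ℂ) * Orient.e o + ((h : ℝ) : ℂ) * Orient.ν o := by
    rw [← hDb]; exact hfoot
  intro w
  rw [rb_rowBeyond_eq_rowTail R h1 h3 hcl hop hδ hδr hv hvn hu hfoot', rb_tailArc_eq R D hDb htd, hDc,
    mem_rowTail_iff]
  constructor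
  · rintro ⟨hw, hne, -, hattr⟩
    exact ⟨hw, hne, hattr⟩
  · rintro ⟨hw, hne, hattr⟩
    exact ⟨hw, hne, hw, hattr⟩

/-! ### Complements of proper arcs -/

/-- **The complement of a proper arc in the frontier is nonempty**: if `β < γ < α + 1` then
`∂D(γ) ∉ ∂D([α, β])` (injectivity of the loop on a period). [folklore] -/
theorem rb_compl_arc_nonempty (D : JordanDomain) {α β γ : ℝ} (h1 : β < γ) (h2 : γ < α + 1) :
    (frontier D.carrier \ D.boundary '' Icc α β).Nonempty := by
  refine ⟨D.boundary γ, D.boundary_mem_frontier γ, ?_⟩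
  rintro ⟨t, ht, heq⟩
  obtain ⟨z, hz⟩ := exists_int_of_boundary_eq D heq
  have hz0 : (z : ℝ) < 0 := by rw [← hz]; linarith [ht.2]
  have hz1 : (-1 : ℝ) < z := by rw [← hz]; linarith [ht.1]
  have : z < 0 := by exact_mod_cast hz0
  have : (-1 : ℤ) < z := by exact_mod_cast hz1
  omega

/-- **Tangential sign at `∂D(td - 1) = ∂D(td)`**: a sign statement on `|t - td| ≤ 2θ` transported
to `|t - (td - 1)| ≤ 2θ` by periodicity. [folklore] -/
theorem rb_sign_shift (D : JordanDomain) {o : Orient} {sT td θ : ℝ}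
    (hT : ∀ t t' : ℝ, |t - td| ≤ 2 * θ → |t' - td| ≤ 2 * θ → t < t' →
      0 < sT * (Orient.tngC o (D.boundary t') - Orient.tngC o (D.boundary t))) :
    ∀ t t' : ℝ, |t - (td - 1)| ≤ 2 * θ → |t' - (td - 1)| ≤ 2 * θ → t < t' →
      0 < sT * (Orient.tngC o (D.boundary t') - Orient.tngC o (D.boundary t)) := by
  intro t t' ht ht' htt'
  have e1 : D.boundary (t + 1) = D.boundary t := D.periodic_boundary t
  have e2 : D.boundary (t' + 1) = D.boundary t' := D.periodic_boundary t'
  rw [← e1, ← e2]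
  exact hT (t + 1) (t' + 1) (by rw [show t + 1 - td = t - (td - 1) by ring]; exact ht)
    (by rw [show t' + 1 - td = t' - (td - 1) by ring]; exact ht') (by linarith)

/-- **Near parameters at `∂D(td - 1) = ∂D(td)`**: frontier points near `∂D(td)` with parameters
within `θ` of `td` have parameters within `θ < 2θ` of `td - 1`. [folklore] -/
theorem rb_near_shift (D : JordanDomain) {td θ ρ : ℝ} (hθ : 0 < θ)
    (hnear : ∀ z ∈ frontier D.carrier, dist z (D.boundary td) < ρ → ∃ t, |t - td| ≤ θ ∧ D.boundary t = z) :
    ∀ z ∈ frontier D.carrier, dist z (D.boundary (td - 1)) < ρ → ∃ t, |t - (td - 1)| < 2 * θ ∧ D.boundary t = z := by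
  intro z hz hzd
  have e1 : D.boundary td = D.boundary (td - 1) := by
    have := D.periodic_boundary (td - 1); rwa [sub_add_cancel] at this
  rw [← e1] at hzd
  obtain ⟨t, ht, rfl⟩ := hnear z hz hzd
  refine ⟨t - 1, ?_, ?_⟩
  · rw [show t - 1 - (td - 1) = t - td by ring]; linarith
  · have := D.periodic_boundary (t - 1); rw [sub_add_cancel] at this; exact this.symm

/-- Near parameters with `≤ θ` give near parameters with `< 2θ`. [folklore] -/
theorem rb_near_weaken (D : JordanDomain) {t₀ θ ρ : ℝ} (hθ : 0 < θ)
    (hnear : ∀ z ∈ frontier D.carrier, dist z (D.boundary t₀) < ρ → ∃ t, |t - t₀| ≤ θ ∧ D.boundary t = z) :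
    ∀ z ∈ frontier D.carrier, dist z (D.boundary t₀) < ρ → ∃ t, |t - t₀| < 2 * θ ∧ D.boundary t = z := by
  intro z hz hzd
  obtain ⟨t, ht, rfl⟩ := hnear z hz hzd
  exact ⟨t, by linarith, rfl⟩

end Summit.CriticalPhenomena.CardyFormulaZ2.Cruxes.RectilinearCardy.ExcursionKernelCovariance

end
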